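import Summits.CriticalPhenomena.PercolationContinuityZ3.Theorems.Transplant.SitePhiMarkov
import Summits.CriticalPhenomena.PercolationContinuityZ3.Theorems.PercNearOneGluingNoHeavyLowerTailCSHLevelForms
import HarnessLib

/-!
# SITE percolation: tools for LEMMA U of the site conditioned slack hierarchy — the site connection relation, world clusters of alive
# and dead vertices, the world covariance, the Markov merge at `C_Y` and the vanishing of `C_Y`-measurable terms
# (WP6 of P1-SITE-Z3 §12/§15; site twin of `Theorems/PercNearOneGluingNoHeavyLowerTailCSHUnfoldOneTools.lean`, general-`k` part)

builds on p205010 (kernel theorem, internal audit signed; external expert review pending).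

Sum level (`BHK2006.weight w`, `Σ weight = 1`), configurations `ζ : Set V` (open vertices); the site WORLD of `ζ` for the avoided set `Y`
deletes the dead set `SiteCSH.worldDead Γ Y ζ = Y ∪ C_Y ∪ ∂C_Y` (p211418; the census-validated site world kernel).  Contents:
* the site connection relation `a b ↦ b ∈ C_a(ζ)` (symmetric, transitive: `siteRel_symm/trans`) feeds the model-free level-form algebra
  `CSH.chi/jn/av/unfoldT/slForm_jn` of `…CSHLevelForms.lean`; dictionary `chi_rel_eq_ind`, `av_rel_eq_ind`, `jn_rel_eq_ind`;
* `avoid Γ s X = {∀ a ∈ X, a ∉ C_s}`;  world clusters: `siteCluster_world_of_avoid` (alive vertex: the world does not change its cluster),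
  `siteCluster_world_eq_empty_of_not_avoid` (dead vertex: EMPTY cluster in every world — the site simplification of the bond "isolated"),
  `worldDead_world_singleton_of_avoid`;
* `wcovOff Γ w Y φ ψ ω = Cov_{world(ω)}(φ, ψ)` with `wcovOff_eq_sum/zero_right/add_right/finset_sum/affine`;
* `set_sum_cond` (Markov at `C_Y`, global form of `set_sum_cond_sdiff_off`), **`markov_merge_Y`**, **`residual_orthogonal`**.
Definitions + proofs (`--supports stmt-CriticalPhenomena-4575 --as helper`); no named facts, no sorries.
[cite: VandenbergHaggstromKahn2005, §2.1 Lemma 2.4 (p. 10); §1 display (10) (pp. 7–8)] [cite: KozmaNitzan2024, Conj. 4 (p. 32)]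
-/

noncomputable section

namespace Summit.CriticalPhenomena.PercolationContinuityZ3.Theorems.Transplant

namespace SiteCSH

open MeasureTheory Set
open Literature.Probability.Percolation
open Literature.Probability.Percolation.BHK2006 (weight weight_nonneg)
open Literature.Probability.Percolation.DecisionTree (ind ind_of_mem ind_of_not_mem ind_nonneg)
open Summit.CriticalPhenomena.PercolationContinuityZ3.Theorems.CSH (chi jn av)
open Summit.CriticalPhenomena.PercolationContinuityZ3.Theorems.SiteTransplant (siteConn)
open SiteGen (siteCluster_mono' siteCluster_eq_of_mem mem_siteConn_iff_mem_siteCluster)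
open SiteBHK (setC)
open scoped Classical

variable {V : Type*} {Γ : SimpleGraph V}

/-! ### The site connection relation and the avoidance events -/

variable (Γ) in
/-- **The site avoidance event `{s ↮ X}`** = `{∀ a ∈ X, a ∉ C_s}`. [cite: VandenbergHaggstromKahn2005, §1 p. 3 (`R_X`)] -/
def avoid (s : V) (X : Set V) : Set (Set V) := {ζ | ∀ a ∈ X, a ∉ siteCluster Γ ζ s}

/-- Membership in the avoidance event. [folklore] -/
theorem mem_avoid {s : V} {X : Set V} {ζ : Set V} : ζ ∈ avoid Γ s X ↔ ∀ a ∈ X, a ∉ siteCluster Γ ζ s := Iff.rfl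

/-- The site connection relation `a b ↦ b ∈ C_a(ζ)` of a configuration (fed to the model-free level-form algebra `CSH.chi/jn/av`)
is symmetric. [folklore] -/
theorem siteRel_symm (ζ : Set V) : ∀ a b : V, b ∈ siteCluster Γ ζ a → a ∈ siteCluster Γ ζ b :=
  fun _ _ ⟨ha, hb, hr⟩ => ⟨hb, ha, hr.symm⟩

/-- The site connection relation is transitive. [folklore] -/
theorem siteRel_trans (ζ : Set V) : ∀ a b c : V, b ∈ siteCluster Γ ζ a → c ∈ siteCluster Γ ζ b → c ∈ siteCluster Γ ζ a :=
  fun _ _ _ ⟨ha, _, hr⟩ ⟨_, hc, hr'⟩ => ⟨ha, hc, hr.trans hr'⟩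

/-- `χ_d(w')` for the site relation of `ζ` is `1{d ↔ w'}(ζ)`. [folklore] -/
theorem chi_rel_eq_ind (ζ : Set V) (w' d : V) :
    chi (fun a b => b ∈ siteCluster Γ ζ a) w' d = ind (siteConn Γ d w') ζ := by
  unfold chi
  by_cases h : d ∈ siteCluster Γ ζ w'
  · rw [if_pos h, ind_of_mem ((mem_siteConn_iff_mem_siteCluster Γ d w' ζ).2 (siteRel_symm ζ _ _ h))]
  · rw [if_neg h, ind_of_not_mem fun h' => h (siteRel_symm ζ _ _ ((mem_siteConn_iff_mem_siteCluster Γ d w' ζ).1 h'))]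

/-- `ε_S(d)` for the site relation of `ζ` is `1{d ↮ S}(ζ)`. [folklore] -/
theorem av_rel_eq_ind (ζ : Set V) (S : Set V) (d : V) :
    av (fun a b => b ∈ siteCluster Γ ζ a) S d = ind (avoid Γ d S) ζ := by
  unfold av
  by_cases h : ∀ s ∈ S, ¬ s ∈ siteCluster Γ ζ d
  · rw [if_pos h, ind_of_mem (show ζ ∈ avoid Γ d S from h)]
  · rw [if_neg h, ind_of_not_mem (show ζ ∉ avoid Γ d S from h)]

/-- `J_S(u)` for the site relation of `ζ` is `1{u ↔ S}(ζ)`. [folklore] -/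
theorem jn_rel_eq_ind (ζ : Set V) (S : Set V) (u : V) :
    jn (fun a b => b ∈ siteCluster Γ ζ a) S u = ind {ζ' : Set V | ∃ s ∈ S, s ∈ siteCluster Γ ζ' u} ζ := by
  unfold jn
  by_cases h : ∃ s ∈ S, s ∈ siteCluster Γ ζ u
  · rw [if_pos h, ind_of_mem (show ζ ∈ {ζ' : Set V | ∃ s ∈ S, s ∈ siteCluster Γ ζ' u} from h)]
  · rw [if_neg h, ind_of_not_mem (show ζ ∉ {ζ' : Set V | ∃ s ∈ S, s ∈ siteCluster Γ ζ' u} from h)]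

/-! ### World clusters: alive vertices keep their cluster, dead vertices have none -/

/-- **Alive vertex**: if `s ↮ Y` in `ζ`, the site world `ζ ∖ worldDead_Y(ζ)` has the same cluster of `s` as `ζ`. [folklore] -/
theorem siteCluster_world_of_avoid {ζ : Set V} {Y : Set V} {s : V} (h : ζ ∈ avoid Γ s Y) :
    siteCluster Γ (ζ \ worldDead Γ Y ζ) s = siteCluster Γ ζ s := by
  refine Subset.antisymm (siteCluster_mono' Γ s Set.sdiff_subset) ?_
  have h' := siteCluster_off_subset (Γ := Γ) s Y ∅ ζ (fun a ha => by rw [Set.sdiff_empty]; exact h a ha)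
  simpa only [Set.sdiff_empty] using h'

/-- Alive vertex, connection events: `ζ ∖ worldDead_Y(ζ) ∈ {s ↔ t} ↔ ζ ∈ {s ↔ t}`. [folklore] -/
theorem mem_siteConn_world_iff_of_avoid {ζ : Set V} {Y : Set V} {s : V} (h : ζ ∈ avoid Γ s Y) (t : V) :
    ζ \ worldDead Γ Y ζ ∈ siteConn Γ s t ↔ ζ ∈ siteConn Γ s t := by
  rw [mem_siteConn_iff_mem_siteCluster, mem_siteConn_iff_mem_siteCluster, siteCluster_world_of_avoid h]

/-- **Dead vertex**: if `d ↔ Y` in `ζ` then `d` is deleted by the world of `ζ`, so its cluster is EMPTY in every configuration read on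
that world. [folklore] -/
theorem siteCluster_world_eq_empty_of_not_avoid {ζ : Set V} {Y : Set V} {d : V} (h : ζ ∉ avoid Γ d Y) (η : Set V) :
    siteCluster Γ (η \ worldDead Γ Y ζ) d = ∅ := by
  have hd : d ∈ worldDead Γ Y ζ := by
    simp only [mem_avoid, not_forall, not_not] at h
    obtain ⟨y, hy, hyd⟩ := h
    exact mem_worldDead_of_mem_siteCluster hy (siteRel_symm ζ d y hyd)
  exact Set.eq_empty_of_forall_notMem fun u hu => hu.1.2 hd

/-- For `d ↮ Y`, exploring the cluster of `d` first does not change the dead set of `Y`: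
`worldDead_Y(ζ ∖ worldDead_{d}(ζ)) = worldDead_Y(ζ)`. [folklore] -/
theorem worldDead_world_singleton_of_avoid {ζ : Set V} {Y : Set V} {d : V} (h : ζ ∈ avoid Γ d Y) :
    worldDead Γ Y (ζ \ worldDead Γ {d} ζ) = worldDead Γ Y ζ := by
  have hc : ∀ y ∈ Y, siteCluster Γ (ζ \ worldDead Γ {d} ζ) y = siteCluster Γ ζ y := fun y hy =>
    siteCluster_world_of_avoid fun a ha => by
      rw [mem_singleton_iff] at ha; subst ha
      exact fun h' => h y hy (siteRel_symm ζ _ _ h')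
  ext u
  constructor
  · rintro (hu | ⟨y, hy, hu | ⟨z, hz, huz⟩⟩)
    · exact Or.inl hu
    · exact Or.inr ⟨y, hy, Or.inl (by rwa [hc y hy] at hu)⟩
    · exact Or.inr ⟨y, hy, Or.inr ⟨z, by rwa [hc y hy] at hz, huz⟩⟩
  · rintro (hu | ⟨y, hy, hu | ⟨z, hz, huz⟩⟩)
    · exact Or.inl hu
    · exact Or.inr ⟨y, hy, Or.inl (by rwa [← hc y hy] at hu)⟩
    · exact Or.inr ⟨y, hy, Or.inr ⟨z, by rwa [← hc y hy] at hz, huz⟩⟩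

/-- `{s ↮ X}` iff `s ∉ C_X` (restated with `avoid`). [folklore] -/
theorem mem_avoid_iff_not_mem_setC [Fintype V] (s : V) (X : Set V) (ζ : Set V) :
    ζ ∈ avoid Γ s X ↔ s ∉ setC Γ Finset.univ X ζ := avoid_iff_not_mem_setC s X ζ

variable [Fintype V]

/-! ### The world covariance -/

variable (Γ) in
/-- **The site world covariance** `Cov_{world(ω)}(φ, ψ) = ḡ(φψ) − ḡ(φ)ḡ(ψ)` (world = delete `worldDead_Y(ω)`; sum level).
[cite: VandenbergHaggstromKahn2005, §2.1 Lemma 2.4 (p. 10)] -/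
def wcovOff (w : V → ℝ) (Y : Set V) (φ ψ : Set V → ℝ) (ω : Set V) : ℝ :=
  wmeanOff Γ w Y (fun β => φ β * ψ β) ω - wmeanOff Γ w Y φ ω * wmeanOff Γ w Y ψ ω

/-- The world covariance as `Σ_η w (φ − ḡ(φ))·ψ`. [folklore] -/
theorem wcovOff_eq_sum (w : V → ℝ) (Y : Set V) (φ ψ : Set V → ℝ) (ω : Set V) :
    wcovOff Γ w Y φ ψ ω =
      ∑ η, weight w η * ((φ (η \ worldDead Γ Y ω) - wmeanOff Γ w Y φ ω) * ψ (η \ worldDead Γ Y ω)) := by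
  have e : ∀ η, weight w η * ((φ (η \ worldDead Γ Y ω) - wmeanOff Γ w Y φ ω) * ψ (η \ worldDead Γ Y ω)) =
      weight w η * (φ (η \ worldDead Γ Y ω) * ψ (η \ worldDead Γ Y ω)) -
        wmeanOff Γ w Y φ ω * (weight w η * ψ (η \ worldDead Γ Y ω)) := by
    intro η; ring
  rw [Finset.sum_congr rfl (fun η _ => e η), Finset.sum_sub_distrib, ← Finset.mul_sum]
  rfl

/-- The world covariance vanishes on the zero test function. [folklore] -/
theorem wcovOff_zero_right (w : V → ℝ) (Y : Set V) (φ : Set V → ℝ) (ω : Set V) :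
    wcovOff Γ w Y φ (fun _ => 0) ω = 0 := by
  rw [wcovOff_eq_sum]; simp

/-- The world covariance is additive in the test function. [folklore] -/
theorem wcovOff_add_right (w : V → ℝ) (Y : Set V) (φ ψ₁ ψ₂ : Set V → ℝ) (ω : Set V) :
    wcovOff Γ w Y φ (fun ζ => ψ₁ ζ + ψ₂ ζ) ω = wcovOff Γ w Y φ ψ₁ ω + wcovOff Γ w Y φ ψ₂ ω := by
  simp only [wcovOff_eq_sum, ← Finset.sum_add_distrib]
  exact Finset.sum_congr rfl fun η _ => by ring

/-- The world covariance commutes with finite linear combinations of test functions. [folklore] -/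
theorem wcovOff_finset_sum (w : V → ℝ) (Y : Set V) (φ : Set V → ℝ) {ι : Type*} (s : Finset ι) (a : ι → ℝ)
    (ψ : ι → Set V → ℝ) (ω : Set V) :
    ∑ i ∈ s, a i * wcovOff Γ w Y φ (ψ i) ω = wcovOff Γ w Y φ (fun ζ => ∑ i ∈ s, a i * ψ i ζ) ω := by
  simp only [wcovOff_eq_sum, Finset.mul_sum]
  rw [Finset.sum_comm]
  refine Finset.sum_congr rfl fun η _ => ?_
  exact Finset.sum_congr rfl fun i _ => by ring

/-- The world covariance of an affine combination: `Cov(φ, ψ₁ − p·ψ₂ − (χ₁ − p·χ₂) + K) = Cov(φ,ψ₁) − p·Cov(φ,ψ₂) − Cov(φ,χ₁) + p·Cov(φ,χ₂)`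
for a CONSTANT `K` (`Σ weight = 1`). [folklore] -/
theorem wcovOff_affine (w : V → ℝ) (hm : ∑ ω, weight w ω = 1) (Y : Set V) (φ ψ₁ ψ₂ χ₁ χ₂ : Set V → ℝ) (p K : ℝ)
    (ω : Set V) :
    wcovOff Γ w Y φ (fun ζ => (ψ₁ ζ - p * ψ₂ ζ) - (χ₁ ζ - p * χ₂ ζ) + K) ω =
      wcovOff Γ w Y φ ψ₁ ω - p * wcovOff Γ w Y φ ψ₂ ω - wcovOff Γ w Y φ χ₁ ω + p * wcovOff Γ w Y φ χ₂ ω := by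
  simp only [wcovOff_eq_sum]
  set D := worldDead Γ Y ω with hD
  have h0 : ∑ η, weight w η * ((φ (η \ D) - wmeanOff Γ w Y φ ω) * K) = 0 := by
    have e0 : ∀ η, weight w η * ((φ (η \ D) - wmeanOff Γ w Y φ ω) * K) =
        K * (weight w η * φ (η \ D)) - K * wmeanOff Γ w Y φ ω * weight w η := by intro η; ring
    rw [Finset.sum_congr rfl (fun η _ => e0 η), Finset.sum_sub_distrib, ← Finset.mul_sum, ← Finset.mul_sum, hm]
    unfold wmeanOff; rw [hD]; ring
  have e : ∀ η, weight w η * ((φ (η \ D) - wmeanOff Γ w Y φ ω) * ((ψ₁ (η \ D) - p * ψ₂ (η \ D)) -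
      (χ₁ (η \ D) - p * χ₂ (η \ D)) + K)) =
      weight w η * ((φ (η \ D) - wmeanOff Γ w Y φ ω) * ψ₁ (η \ D)) -
        p * (weight w η * ((φ (η \ D) - wmeanOff Γ w Y φ ω) * ψ₂ (η \ D))) -
        weight w η * ((φ (η \ D) - wmeanOff Γ w Y φ ω) * χ₁ (η \ D)) +
        p * (weight w η * ((φ (η \ D) - wmeanOff Γ w Y φ ω) * χ₂ (η \ D))) +
        weight w η * ((φ (η \ D) - wmeanOff Γ w Y φ ω) * K) := by intro η; ring
  rw [Finset.sum_congr rfl (fun η _ => e η), Finset.sum_add_distrib, h0, add_zero, Finset.sum_add_distrib,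
    Finset.sum_sub_distrib, Finset.sum_sub_distrib, ← Finset.mul_sum, ← Finset.mul_sum]

/-! ### Markov at `C_Y`: merging the world double sum, and the vanishing of `C_Y`-measurable terms -/

/-- **Conditioning on the cluster of `Y`** (global form of `set_sum_cond_sdiff_off`): the kernel `K(C_Y(ω), ·)` integrated in the world of
`ω` equals, summed over `ω`, its value at the configuration itself. [cite: VandenbergHaggstromKahn2005, §2.1 Lemma 2.4 (p. 10)] -/
theorem set_sum_cond (w : V → ℝ) (hm : ∑ ω, weight w ω = 1) (X : Set V) (K : Set V → Set V → ℝ) :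
    ∑ ω, weight w ω * K (setC Γ Finset.univ X ω) (ω \ worldDead Γ X ω) =
      ∑ ω, weight w ω * ∑ η, weight w η * K (setC Γ Finset.univ X ω) (η \ worldDead Γ X ω) := by
  have h := set_sum_cond_sdiff_off (Γ := Γ) w hm X ∅ K
  simp only [Set.sdiff_empty, ← worldDead_eq_deadOf] at h
  exact h

/-- The avoidance indicator as a function of the cluster of `Y`. [folklore] -/
theorem ind_avoid_eq_ite (x : V) (Y : Set V) (ζ : Set V) :
    ind (avoid Γ x Y) ζ = if x ∈ setC Γ Finset.univ Y ζ then 0 else 1 := by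
  by_cases h : x ∈ setC Γ Finset.univ Y ζ
  · rw [if_pos h, ind_of_not_mem fun h' => (mem_avoid_iff_not_mem_setC x Y ζ).1 h' h]
  · rw [if_neg h, ind_of_mem ((mem_avoid_iff_not_mem_setC x Y ζ).2 h)]

/-- The world mean as a function of the cluster of `Y`. [folklore] -/
theorem wmeanOff_eq_sum_deadOf (w : V → ℝ) (Y : Set V) (φ : Set V → ℝ) (ζ : Set V) :
    wmeanOff Γ w Y φ ζ = ∑ η', weight w η' * φ (η' \ SiteBHK.deadOf Γ Y (setC Γ Finset.univ Y ζ)) := by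
  rw [wmeanOff, worldDead_eq_deadOf]

/-- **Markov merge at `C_Y` (site).**  For any world test function `ψ`:
`Σ_ω w 1_D(ω) Σ_η w (g(C_x(η')) − ḡ(ω)) ψ(η')  [η' = η ∖ worldDead_Y ω]  =  Σ_ζ w 1_D(ζ) (g(C_x ζ) − ḡ(ζ)) ψ(ζ ∖ worldDead_Y ζ)`
(`D = {x ↮ Y}`; on `D` the world does not change the cluster of `x`). [cite: VandenbergHaggstromKahn2005, §2.1 Lemma 2.4 (p. 10) — corollary] -/
theorem markov_merge_Y (w : V → ℝ) (hm : ∑ ω, weight w ω = 1) (x : V) (Y : Set V) (g : Set V → ℝ) (ψ : Set V → ℝ) :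
    ∑ ω, weight w ω * (ind (avoid Γ x Y) ω *
        ∑ η, weight w η * ((g (siteCluster Γ (η \ worldDead Γ Y ω) x) -
          wmeanOff Γ w Y (fun β => g (siteCluster Γ β x)) ω) * ψ (η \ worldDead Γ Y ω))) =
      ∑ ζ, weight w ζ * (ind (avoid Γ x Y) ζ *
        ((g (siteCluster Γ ζ x) - wmeanOff Γ w Y (fun β => g (siteCluster Γ β x)) ζ) * ψ (ζ \ worldDead Γ Y ζ))) := by
  -- kernel: K(W, β) = 1{x ∉ W} · (g(C_x β) − ḡ_W) · ψ(β), ḡ_W = Σ_η' w g(C_x(η' ∖ deadOf Y W))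
  set K : Set V → Set V → ℝ := fun W β =>
    (if x ∈ W then 0 else 1) *
      ((g (siteCluster Γ β x) - ∑ η', weight w η' * g (siteCluster Γ (η' \ SiteBHK.deadOf Γ Y W) x)) * ψ β) with hK
  have key := set_sum_cond w hm Y K (Γ := Γ)
  -- right-hand side of `key` is our left-hand side
  have hR : ∀ ω, weight w ω * ∑ η, weight w η * K (setC Γ Finset.univ Y ω) (η \ worldDead Γ Y ω) =
      weight w ω * (ind (avoid Γ x Y) ω * ∑ η, weight w η * ((g (siteCluster Γ (η \ worldDead Γ Y ω) x) -
        wmeanOff Γ w Y (fun β => g (siteCluster Γ β x)) ω) * ψ (η \ worldDead Γ Y ω))) := by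
    intro ω
    rw [ind_avoid_eq_ite, wmeanOff_eq_sum_deadOf]
    congr 1
    rw [Finset.mul_sum]
    exact Finset.sum_congr rfl fun η _ => by simp only [hK]; ring
  -- left-hand side of `key` is our right-hand side
  have hL : ∀ ζ, weight w ζ * K (setC Γ Finset.univ Y ζ) (ζ \ worldDead Γ Y ζ) =
      weight w ζ * (ind (avoid Γ x Y) ζ * ((g (siteCluster Γ ζ x) -
        wmeanOff Γ w Y (fun β => g (siteCluster Γ β x)) ζ) * ψ (ζ \ worldDead Γ Y ζ))) := by
    intro ζ
    simp only [hK]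
    rw [ind_avoid_eq_ite, wmeanOff_eq_sum_deadOf]
    by_cases h : x ∈ setC Γ Finset.univ Y ζ
    · simp only [if_pos h, zero_mul, mul_zero]
    · have hζ : ζ ∈ avoid Γ x Y := (mem_avoid_iff_not_mem_setC x Y ζ).2 h
      rw [if_neg h, siteCluster_world_of_avoid hζ]
  calc _ = ∑ ω, weight w ω * ∑ η, weight w η * K (setC Γ Finset.univ Y ω) (η \ worldDead Γ Y ω) :=
        Finset.sum_congr rfl fun ω _ => (hR ω).symm
    _ = ∑ ζ, weight w ζ * K (setC Γ Finset.univ Y ζ) (ζ \ worldDead Γ Y ζ) := key.symm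
    _ = _ := Finset.sum_congr rfl fun ζ _ => hL ζ

/-- **`C_Y`-measurable terms vanish against the residual** (site): for any function `κ` of the cluster of `Y`,
`Σ_ζ w 1_D(ζ) κ(C_Y ζ) (g(C_x ζ) − ḡ(ζ)) = 0`. [cite: VandenbergHaggstromKahn2005, §2.1 Lemma 2.4 (p. 10) — corollary] -/
theorem residual_orthogonal (w : V → ℝ) (hm : ∑ ω, weight w ω = 1) (x : V) (Y : Set V) (g : Set V → ℝ)
    (κ : Set V → ℝ) :
    ∑ ζ, weight w ζ * (ind (avoid Γ x Y) ζ * (κ (setC Γ Finset.univ Y ζ) *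
      (g (siteCluster Γ ζ x) - wmeanOff Γ w Y (fun β => g (siteCluster Γ β x)) ζ))) = 0 := by
  set K : Set V → Set V → ℝ := fun W β =>
    (if x ∈ W then 0 else 1) * (κ W *
      (g (siteCluster Γ β x) - ∑ η', weight w η' * g (siteCluster Γ (η' \ SiteBHK.deadOf Γ Y W) x))) with hK
  have key := set_sum_cond w hm Y K (Γ := Γ)
  have hL : ∀ ζ, weight w ζ * K (setC Γ Finset.univ Y ζ) (ζ \ worldDead Γ Y ζ) =
      weight w ζ * (ind (avoid Γ x Y) ζ * (κ (setC Γ Finset.univ Y ζ) *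
        (g (siteCluster Γ ζ x) - wmeanOff Γ w Y (fun β => g (siteCluster Γ β x)) ζ))) := by
    intro ζ
    simp only [hK]
    rw [ind_avoid_eq_ite, wmeanOff_eq_sum_deadOf]
    by_cases h' : x ∈ setC Γ Finset.univ Y ζ
    · simp only [if_pos h', zero_mul, mul_zero]
    · have hζ : ζ ∈ avoid Γ x Y := (mem_avoid_iff_not_mem_setC x Y ζ).2 h'
      rw [if_neg h', siteCluster_world_of_avoid hζ]
  have hR : ∀ ω, weight w ω * ∑ η, weight w η * K (setC Γ Finset.univ Y ω) (η \ worldDead Γ Y ω) = 0 := by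
    intro ω
    set W := setC Γ Finset.univ Y ω with hW
    have hdead : SiteBHK.deadOf Γ Y W = worldDead Γ Y ω := by rw [hW, ← worldDead_eq_deadOf]
    have e : ∀ η, weight w η * K W (η \ worldDead Γ Y ω) =
        ((if x ∈ W then 0 else 1) * κ W) * (weight w η * g (siteCluster Γ (η \ worldDead Γ Y ω) x)) -
          ((if x ∈ W then 0 else 1) * κ W *
            ∑ η', weight w η' * g (siteCluster Γ (η' \ worldDead Γ Y ω) x)) * weight w η := by
      intro η; simp only [hK, hdead]; ring
    rw [Finset.sum_congr rfl (fun η _ => e η), Finset.sum_sub_distrib, ← Finset.mul_sum, ← Finset.mul_sum, hm]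
    ring
  calc _ = ∑ ζ, weight w ζ * K (setC Γ Finset.univ Y ζ) (ζ \ worldDead Γ Y ζ) :=
        Finset.sum_congr rfl fun ζ _ => (hL ζ).symm
    _ = ∑ ω, weight w ω * ∑ η, weight w η * K (setC Γ Finset.univ Y ω) (η \ worldDead Γ Y ω) := key
    _ = 0 := Finset.sum_eq_zero fun ω _ => hR ω

end SiteCSH

end Summit.CriticalPhenomena.PercolationContinuityZ3.Theorems.Transplant
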